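import Mathlib
import HarnessLib
import Summits.ABC.ABC.Theses.TwistAmplification

/-!
# `SharpLawGivesWindow` — the crux → target glue of route TwistAmplification

Item stmt-ABC-14144: `SharpModerateLaw → ModerateWindowCount`.

Given `σ > 6` we take the fixed window exponent `κ := 4` and
`ε := (σ − 6) / (6 (2σ − 6)) > 0` (half the margin `(σ−4)/(2σ−6) − (1 − 4/6)` at `κ = 4`),
obtain the constant `C` from `SharpModerateLaw 4 σ ε`, and answer with
`(κ, δ, C) := (4, 1 − 4/6 + ε, C)`.  The counted set of `ModerateWindowCount` at `(4, σ)` is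
literally the counted set of `SharpModerateLaw` at `(4, σ)`, so the bound is the same term, and
`δ < (σ − 4)/(2σ − 6)` because `(σ−4)/(2σ−6) − 1/3 − ε = ε > 0`.
-/

-- `Summit.<Summit>.<Problem>` is the mandated summit-side namespace (CONVENTIONS §2); for the
-- single-conjunct summit `ABC` the two coincide, so the duplicate `ABC.ABC` is deliberate.
set_option linter.dupNamespace false

namespace Summit.ABC.ABC.Theorems

open Summit.ABC.ABC.Theses.TwistAmplification

/-- The margin inequality at `κ = 4`: for `σ > 6` and `ε := (σ − 6) / (6 (2σ − 6))`,
`1 − 4/6 + ε < (σ − 4) / (2σ − 6)` (indeed the difference is exactly `ε`). -/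
theorem sharpLawGivesWindow_margin (σ : ℝ) (hσ : 6 < σ) :
    1 - 4 / 6 + (σ - 6) / (6 * (2 * σ - 6)) < (σ - 4) / (2 * σ - 6) := by
  have hden : 0 < 2 * σ - 6 := by linarith
  have hlhs : 1 - 4 / 6 + (σ - 6) / (6 * (2 * σ - 6)) = (5 * σ - 18) / (6 * (2 * σ - 6)) := by
    rw [eq_div_iff (by positivity), add_mul, div_mul_cancel₀ _ (by positivity)]
    ring
  have hrhs : (σ - 4) / (2 * σ - 6) = (6 * σ - 24) / (6 * (2 * σ - 6)) := by
    rw [mul_comm (6 : ℝ) (2 * σ - 6), ← div_div, eq_div_iff (by norm_num : (6 : ℝ) ≠ 0),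
      div_mul_eq_mul_div]
    congr 1
    ring
  rw [hlhs, hrhs, div_lt_div_iff_of_pos_right (by positivity)]
  linarith

/-- **stmt-ABC-14144** (`SharpLawGivesWindow`): the sharp moderate counting law
`T⁺_[κ,σ](X) ≤ C · X^{1 − κ/6 + ε}` on `3 < κ < 6 < σ` implies the moderate-window count
(for every `σ > 6` some window `(κ, σ]`, `κ > 3`, is counted with saving `δ < (σ−κ)/(2σ−6)`),
via `κ := 4`, `ε := (σ−6)/(6(2σ−6))`, `δ := 1 − 4/6 + ε`. -/
theorem sharpLawGivesWindow_proof : SharpLawGivesWindow := by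
  unfold SharpLawGivesWindow
  intro hSharp
  unfold ModerateWindowCount
  intro σ hσ
  have hden : 0 < 2 * σ - 6 := by linarith
  have hε : 0 < (σ - 6) / (6 * (2 * σ - 6)) := div_pos (by linarith) (by positivity)
  obtain ⟨C, hC⟩ := hSharp 4 σ ((σ - 6) / (6 * (2 * σ - 6))) (by norm_num) (by norm_num) hσ hε
  refine ⟨4, 1 - 4 / 6 + (σ - 6) / (6 * (2 * σ - 6)), C, by norm_num, by linarith,
    sharpLawGivesWindow_margin σ hσ, ?_⟩
  intro X hX
  exact hC X hX

end Summit.ABC.ABC.Theorems
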